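import Mathlib
import HarnessLib
import Literature.MathematicalPhysics.QuantumFieldTheory.ConstructiveQFTWave0

/-!
# LatticeQCDFlow / Scaling — the staircase configuration: extensive Wilson action from ONE group
element, for every gauge group and every volume `L ≥ 2` (v2.5)

HONEST FRAMING: exact (Metropolis-corrected) sampling algorithms for lattice gauge theory; figures
of merit are autocorrelation/cost numbers at stated couplings and volumes; no continuum-physics
claim.

Venture `LatticeQCDFlow` (cell pub-lqcd), topic `Scaling`, FANOUT row 29 (theory2) — OUR WORK
(THEORY-2.md v2.5 §3.3, row C2a).  The transport-rigidity theorem (C2a)/(C2a-R) needs, besides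
Haar ball volumes, an EXTENSIVE-ACTION configuration at every volume: `∃ V, s₀·L^d ≤ S(V)`.  Row 30
built one for `U(N)`, `SU(N)`, `N ≥ 2` from a pair of non-commuting elements (all `L`), and
`Scaling/U1ExtensiveAction.lean` one for `U(1)` from a half-turn twist (`L ≥ 2`).  Here is the
uniform statement behind both, for an ARBITRARY group `G`, representation `ρ` with
`Re tr ρ ≤ N`, dimension `d ≥ 2` and volume `L ≥ 2`: for any `g : G` the STAIRCASE configuration
`U(x, e₀) = (g^{x₁})⁻¹` (exponent `x₁ ∈ {0, …, L−1}`), all other links `1`, has every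
`(e₀, e₁)`-plaquette off the last slice `x₁ = L − 1` equal to `g` exactly
(`plaquetteHolonomy_staircase_of_lt`); at least half of the sites are off that slice
(`card_offSlice_ge`, by the shift injection `x ↦ x + e₁`); hence
`S(staircase g) ≥ (L^d / 2)·(N − Re tr ρ(g))` (`wilsonAction_staircase_ge`), and a representation
with a non-constant character has `∃ s₀ > 0, ∀ L ≥ 2, ∃ V, s₀·L^d ≤ S(V)`
(`extensive_action_of_nonconstant`) — exactly the volume hypothesis of (C2a-R) in
`Scaling/ConjecturesRepaired.lean`, for every `G`.  No wrap-around bookkeeping is needed: the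
`L^{d−1}` plaquettes on the last slice are merely non-negative.  Elementary; nothing is cited as a
fact.
-/

noncomputable section

open Literature.MathematicalPhysics.QuantumFieldTheory

namespace Summit.Ventures.LatticeQCDFlow.Theory2.Lattice

variable {d N : ℕ} {G : Type*} [Group G]

/-- The first lattice axis (needs `d ≥ 2`). [folklore] -/
def axis0 (hd : 2 ≤ d) : Fin d := ⟨0, by omega⟩

/-- The second lattice axis (needs `d ≥ 2`). [folklore] -/
def axis1 (hd : 2 ≤ d) : Fin d := ⟨1, by omega⟩

/-- `axis1 ≠ axis0`. [folklore] -/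
theorem axis1_ne_axis0 (hd : 2 ≤ d) : axis1 hd ≠ axis0 hd := by
  simp [axis0, axis1, Fin.ext_iff]

/-- `axis0 < axis1`. [folklore] -/
theorem axis0_lt_axis1 (hd : 2 ≤ d) : axis0 hd < axis1 hd := by
  simp [axis0, axis1, Fin.lt_def]

/-- The STAIRCASE configuration of `g`: `U(x, e₀) = (g^{x₁})⁻¹` with the exponent
`x₁ = (x e₁).val ∈ {0, …, L−1}`, every other link `1`. [folklore] -/
def staircase (hd : 2 ≤ d) (L : ℕ) (g : G) : GaugeConfig d L G := fun e =>
  if e.2 = axis0 hd then (g ^ (e.1 (axis1 hd)).val)⁻¹ else 1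

/-- The `(e₀, e₁)`-plaquette holonomy of the staircase. [folklore] -/
theorem plaquetteHolonomy_staircase {L : ℕ} (hd : 2 ≤ d) (g : G) (x : Site d L) :
    plaquetteHolonomy (staircase hd L g) x (axis0 hd) (axis1 hd) =
      (g ^ (x (axis1 hd)).val)⁻¹ * g ^ ((x (axis1 hd)) + 1).val := by
  have h10 := axis1_ne_axis0 hd
  have hs1 : (x.shift (axis1 hd)) (axis1 hd) = x (axis1 hd) + 1 := by
    simp [Site.shift]
  unfold plaquetteHolonomy
  simp only [staircase, if_neg h10, hs1, mul_one, inv_one, inv_inv, reduceIte]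

/-- Off the last slice (`x₁ + 1 < L`) the staircase plaquette is exactly `g`. [folklore] -/
theorem plaquetteHolonomy_staircase_of_lt {L : ℕ} (hd : 2 ≤ d) (g : G) (x : Site d L)
    (hx : (x (axis1 hd)).val + 1 < L) :
    plaquetteHolonomy (staircase hd L g) x (axis0 hd) (axis1 hd) = g := by
  rw [plaquetteHolonomy_staircase]
  haveI : Fact (1 < L) := ⟨by omega⟩
  have h1 : ((x (axis1 hd)) + 1).val = (x (axis1 hd)).val + 1 := by
    rw [ZMod.val_add_of_lt (by rwa [ZMod.val_one]), ZMod.val_one]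
  rw [h1, pow_succ, inv_mul_cancel_left]

/-- At least half of the sites lie off the last slice `x₁ = L − 1` when `L ≥ 2`: the shift
`x ↦ x + e₁` injects the slice into its complement. [folklore] -/
theorem card_offSlice_ge {L : ℕ} [NeZero L] (hd : 2 ≤ d) (hL : 2 ≤ L) :
    (L : ℝ) ^ d / 2 ≤
      ((Finset.univ.filter fun x : Site d L => (x (axis1 hd)).val + 1 < L).card : ℝ) := by
  set B := Finset.univ.filter fun x : Site d L => (x (axis1 hd)).val + 1 < L with hB
  set A := Finset.univ.filter fun x : Site d L => ¬ ((x (axis1 hd)).val + 1 < L) with hA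
  have hAB : B.card + A.card = Fintype.card (Site d L) := by
    rw [hB, hA, Finset.card_filter_add_card_filter_not, Finset.card_univ]
  have hcard : (Fintype.card (Site d L) : ℝ) = (L : ℝ) ^ d := by
    rw [Fintype.card_fun, ZMod.card, Fintype.card_fin]
    push_cast
    rfl
  have hAleB : A.card ≤ B.card := by
    refine Finset.card_le_card_of_injOn (fun x => x.shift (axis1 hd)) ?_ ?_
    · intro x hx
      rw [Finset.mem_coe, hA, Finset.mem_filter] at hx
      rw [Finset.mem_coe, hB, Finset.mem_filter]
      refine ⟨Finset.mem_univ _, ?_⟩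
      have hs : (x.shift (axis1 hd)) (axis1 hd) = x (axis1 hd) + 1 := by simp [Site.shift]
      have hv : (x (axis1 hd)).val = L - 1 := by
        have := ZMod.val_lt (x (axis1 hd))
        omega
      haveI : Fact (1 < L) := ⟨by omega⟩
      show ((x.shift (axis1 hd)) (axis1 hd)).val + 1 < L
      rw [hs, ZMod.val_add, hv, ZMod.val_one, Nat.sub_add_cancel (by omega : 1 ≤ L),
        Nat.mod_self]
      omega
    · intro x _ y _ hxy
      simpa [Site.shift] using hxy
  have h1 : (A.card : ℝ) ≤ B.card := by exact_mod_cast hAleB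
  have h2 : (B.card : ℝ) + A.card = (L : ℝ) ^ d := by
    rw [← hcard]
    exact_mod_cast hAB
  linarith

/-- **`S(staircase g) ≥ (L^d/2)·(N − Re tr ρ(g))`** for every group `G`, representation `ρ` with
`Re tr ρ ≤ N`, `d ≥ 2`, `L ≥ 2`. [folklore] -/
theorem wilsonAction_staircase_ge {L : ℕ} [NeZero L] (ρ : G →* Matrix (Fin N) (Fin N) ℂ)
    (htr : ∀ h : G, (ρ h).trace.re ≤ N) (hd : 2 ≤ d) (hL : 2 ≤ L) (g : G) :
    (L : ℝ) ^ d / 2 * ((N : ℝ) - (ρ g).trace.re) ≤ wilsonAction ρ (staircase hd L g) := by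
  unfold wilsonAction
  rw [Fintype.sum_prod_type]
  set q0 : {p : Fin d × Fin d // p.1 < p.2} := ⟨(axis0 hd, axis1 hd), axis0_lt_axis1 hd⟩
    with hq0
  have hs0 : 0 ≤ (N : ℝ) - (ρ g).trace.re := sub_nonneg.2 (htr g)
  have hnn : ∀ (x : Site d L) (q : {p : Fin d × Fin d // p.1 < p.2}),
      0 ≤ (N : ℝ) - (ρ (plaquetteHolonomy (staircase hd L g) x q.1.1 q.1.2)).trace.re :=
    fun x q => sub_nonneg.2 (htr _)
  set B := Finset.univ.filter fun x : Site d L => (x (axis1 hd)).val + 1 < L with hB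
  calc (L : ℝ) ^ d / 2 * ((N : ℝ) - (ρ g).trace.re)
        ≤ (B.card : ℝ) * ((N : ℝ) - (ρ g).trace.re) :=
        mul_le_mul_of_nonneg_right (card_offSlice_ge hd hL) hs0
    _ = ∑ _x ∈ B, ((N : ℝ) - (ρ g).trace.re) := by rw [Finset.sum_const, nsmul_eq_mul]
    _ = ∑ x ∈ B, ((N : ℝ) -
          (ρ (plaquetteHolonomy (staircase hd L g) x (axis0 hd) (axis1 hd))).trace.re) := by
        refine Finset.sum_congr rfl fun x hx => ?_
        rw [hB, Finset.mem_filter] at hx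
        rw [plaquetteHolonomy_staircase_of_lt hd g x hx.2]
    _ ≤ ∑ x, ((N : ℝ) -
          (ρ (plaquetteHolonomy (staircase hd L g) x (axis0 hd) (axis1 hd))).trace.re) :=
        Finset.sum_le_sum_of_subset_of_nonneg (Finset.subset_univ _)
          fun x _ _ => sub_nonneg.2 (htr _)
    _ ≤ ∑ x : Site d L, ∑ q : {p : Fin d × Fin d // p.1 < p.2}, ((N : ℝ) -
          (ρ (plaquetteHolonomy (staircase hd L g) (x, q).1 (x, q).2.1.1
            (x, q).2.1.2)).trace.re) := by
        refine Finset.sum_le_sum fun x _ => ?_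
        have h := Finset.single_le_sum (f := fun q : {p : Fin d × Fin d // p.1 < p.2} =>
          (N : ℝ) - (ρ (plaquetteHolonomy (staircase hd L g) x q.1.1 q.1.2)).trace.re)
          (fun q _ => hnn x q) (Finset.mem_univ q0)
        simpa [hq0] using h

/-- **Extensive action from one element**: for every `g`, `d ≥ 2`, `L ≥ 2` there is a
configuration with `(L^d/2)·(N − Re tr ρ(g)) ≤ S`. [folklore] -/
theorem extensive_action_of_elt (ρ : G →* Matrix (Fin N) (Fin N) ℂ)
    (htr : ∀ h : G, (ρ h).trace.re ≤ N) (hd : 2 ≤ d) (g : G) (L : ℕ) [NeZero L]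
    (hL : 2 ≤ L) :
    ∃ V : GaugeConfig d L G, (L : ℝ) ^ d / 2 * ((N : ℝ) - (ρ g).trace.re) ≤ wilsonAction ρ V :=
  ⟨staircase hd L g, wilsonAction_staircase_ge ρ htr hd hL g⟩

/-- **The volume hypothesis of (C2a-R) for every gauge group**: a representation with
`Re tr ρ ≤ N` and a non-constant character admits `s₀ > 0` with
`∀ L ≥ 2, ∃ V, s₀·L^d ≤ S(V)` (`d ≥ 2`). [folklore] -/
theorem extensive_action_of_nonconstant (ρ : G →* Matrix (Fin N) (Fin N) ℂ)
    (htr : ∀ h : G, (ρ h).trace.re ≤ N) (hρ : ∃ g : G, (ρ g).trace.re ≠ N) (hd : 2 ≤ d) :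
    ∃ s₀ : ℝ, 0 < s₀ ∧ ∀ (L : ℕ) [NeZero L], 2 ≤ L →
      ∃ V : GaugeConfig d L G, s₀ * (L : ℝ) ^ d ≤ wilsonAction ρ V := by
  obtain ⟨g, hg⟩ := hρ
  have hlt : (ρ g).trace.re < N := lt_of_le_of_ne (htr g) hg
  refine ⟨((N : ℝ) - (ρ g).trace.re) / 2, by linarith, fun L _ hL => ?_⟩
  obtain ⟨V, hV⟩ := extensive_action_of_elt ρ htr hd g L hL
  exact ⟨V, le_of_eq_of_le (by ring) hV⟩

end Summit.Ventures.LatticeQCDFlow.Theory2.Lattice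

end
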